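import Mathlib
import Literature.Computability.Complexity.RangeAvoidance

/-!
# The XOR multigraph of a `P⋆` instance: leafless cores and short paths (tools for the linearisability obstruction)

FRONTIER range-avoidance ladder, ROUND-24 calibration (cell `pnp-ideate`; restricted-model combinatorics — nothing here bears
on `P` versus `NP`).

For a `4`-local instance `I : LocalMap 4 n m` every output `j` has an XOR PAIR `xpair I j = {vars j 0, vars j 1}`; a set `S` of
outputs is a multigraph on `Fin n` through these pairs.  This file is the elementary multigraph theory the obstruction
`PstarLinearisableNotExpanding` needs, done on finsets without any graph library:

* `card_le_card_xverts`: if every nonempty subset of `S` has a LEAF (a vertex of `x`-degree exactly `1`) then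
  `|S| ≤ |xverts S|` (peel a leaf edge; it takes its leaf vertex with it) — so a set with more outputs than vertices contains
  a nonempty LEAFLESS subset (`exists_leafless`);
* `path_or_small_leafless`: inside a nonempty leafless set `K` (all touched vertices have degree `≥ 2`), for every `ℓ ≥ 1`
  there is either a simple `x`-path with `ℓ` edges of `K` (`IsXPath`) or a nonempty leafless subset of `K` with at most `ℓ`
  outputs (greedy walk: extend the path at its last vertex by a second edge; if the new endpoint is on the path, the closed
  part is a leafless set);
* `leaves_of_isXPath`: the only possible leaves of the edge set of a simple path are its two end vertices.
-/

set_option linter.dupNamespace false -- `Summit.PneNP.PneNP.…`: summit = sub-problem name (D-0017 single-conjunct layout)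

open Finset Literature.Computability.Complexity

namespace Summit.PneNP.PneNP.Theorems.PstarXCore

variable {n m : ℕ} (I : LocalMap 4 n m)

/-! ## XOR pairs, degrees, leaves -/

/-- The XOR pair of output `j` (slots `0, 1`). -/
def xpair (j : Fin m) : Finset (Fin n) := {I.vars j 0, I.vars j 1}

/-- Membership in the XOR pair. -/
theorem mem_xpair {j : Fin m} {u : Fin n} : u ∈ xpair I j ↔ u = I.vars j 0 ∨ u = I.vars j 1 := by
  simp [xpair]

/-- The XOR pair has at most two elements. -/
theorem card_xpair_le (j : Fin m) : (xpair I j).card ≤ 2 := card_insert_le _ _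

/-- The `x`-degree of a vertex in a set of outputs: the number of outputs of `S` whose XOR pair contains it. -/
def xdeg (S : Finset (Fin m)) (u : Fin n) : ℕ := (S.filter fun j => u ∈ xpair I j).card

/-- The vertices touched by the XOR pairs of `S`. -/
def xverts (S : Finset (Fin m)) : Finset (Fin n) := S.biUnion (xpair I)

/-- LEAFLESS: no vertex has `x`-degree exactly one in `S`. -/
def Leafless (S : Finset (Fin m)) : Prop := ∀ u, xdeg I S u ≠ 1

/-- A set in which every endpoint of every member pair is covered by a second member is leafless. -/
theorem leafless_of_cover (S : Finset (Fin m))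
    (h : ∀ j ∈ S, ∀ u ∈ xpair I j, ∃ j' ∈ S, j' ≠ j ∧ u ∈ xpair I j') : Leafless I S := by
  intro u hu
  obtain ⟨j, hj⟩ := card_eq_one.1 hu
  have hjm : j ∈ S.filter (fun j => u ∈ xpair I j) := by rw [hj]; exact mem_singleton_self _
  rw [mem_filter] at hjm
  obtain ⟨j', hj'S, hne, hu'⟩ := h j hjm.1 u hjm.2
  have : j' ∈ S.filter (fun j => u ∈ xpair I j) := mem_filter.2 ⟨hj'S, hu'⟩
  rw [hj, mem_singleton] at this
  exact hne this

/-- In a leafless set a touched vertex has degree at least two. -/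
theorem two_le_xdeg {K : Finset (Fin m)} (hK : Leafless I K) {j : Fin m} (hj : j ∈ K) {u : Fin n}
    (hu : u ∈ xpair I j) : 2 ≤ xdeg I K u := by
  have h1 : 1 ≤ xdeg I K u := card_pos.2 ⟨j, mem_filter.2 ⟨hj, hu⟩⟩
  have h2 := hK u
  unfold xdeg at *
  omega

/-! ## Peeling: more outputs than vertices forces a leafless core -/

/-- **Forest bound.**  If every nonempty subset of `S` has a leaf then `|S| ≤ |xverts S|`. -/
theorem card_le_card_xverts (S : Finset (Fin m))
    (h : ∀ S' ⊆ S, S'.Nonempty → ∃ u, xdeg I S' u = 1) : S.card ≤ (xverts I S).card := by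
  induction S using Finset.strongInduction with
  | H S ih =>
    rcases S.eq_empty_or_nonempty with rfl | hne
    · simp
    obtain ⟨u, hu⟩ := h S (Subset.refl _) hne
    obtain ⟨j, hj⟩ := card_eq_one.1 hu
    have hjm : j ∈ S.filter (fun j => u ∈ xpair I j) := by rw [hj]; exact mem_singleton_self _
    rw [mem_filter] at hjm
    have hsub : S.erase j ⊂ S := erase_ssubset hjm.1
    have ih' := ih (S.erase j) hsub (fun T hT hTne => h T (hT.trans (erase_subset _ _)) hTne)
    have hu' : u ∉ xverts I (S.erase j) := by
      intro hu'
      obtain ⟨j', hj'S, huj'⟩ := mem_biUnion.1 hu'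
      have : j' ∈ S.filter (fun j => u ∈ xpair I j) := mem_filter.2 ⟨mem_of_mem_erase hj'S, huj'⟩
      rw [hj, mem_singleton] at this
      exact (ne_of_mem_erase hj'S) this
    have hsub2 : xverts I (S.erase j) ⊆ (xverts I S).erase u := by
      intro w hw
      rw [mem_erase]
      refine ⟨fun h' => hu' (h' ▸ hw), ?_⟩
      obtain ⟨j', hj'S, hwj'⟩ := mem_biUnion.1 hw
      exact mem_biUnion.2 ⟨j', mem_of_mem_erase hj'S, hwj'⟩
    have huS : u ∈ xverts I S := mem_biUnion.2 ⟨j, hjm.1, hjm.2⟩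
    have h3 := card_le_card hsub2
    rw [card_erase_of_mem huS] at h3
    have h4 := card_erase_add_one hjm.1
    have h5 : 1 ≤ (xverts I S).card := card_pos.2 ⟨u, huS⟩
    omega

/-- **A nonempty leafless core exists** as soon as `S` has more outputs than touched vertices. -/
theorem exists_leafless (S : Finset (Fin m)) (hS : (xverts I S).card < S.card) :
    ∃ K ⊆ S, K.Nonempty ∧ Leafless I K := by
  by_contra hcon
  push Not at hcon
  have := card_le_card_xverts I S (fun S' hS' hne => by
    have h := hcon S' hS' hne
    unfold Leafless at h
    push Not at h
    exact h)
  omega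

/-! ## Simple `x`-paths and the greedy walk -/

/-- A SIMPLE `x`-PATH of length `ℓ` inside `K`: distinct vertices `v 0, …, v ℓ`, distinct outputs `e 0, …, e (ℓ-1)` of `K`,
the XOR pair of `e i` being `{v i, v (i+1)}` (indexed by naturals; values beyond the range are irrelevant). -/
def IsXPath (K : Finset (Fin m)) (ℓ : ℕ) (v : ℕ → Fin n) (e : ℕ → Fin m) : Prop :=
  (∀ i ≤ ℓ, ∀ i' ≤ ℓ, v i = v i' → i = i') ∧ (∀ i < ℓ, ∀ i' < ℓ, e i = e i' → i = i') ∧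
    (∀ i < ℓ, e i ∈ K) ∧ ∀ i < ℓ, xpair I (e i) = {v i, v (i + 1)}

variable {I}

/-- The other endpoint of an XOR pair through a given vertex (pairs of instances with injective positions are proper). -/
theorem exists_other (hinj : ∀ j, Function.Injective (I.vars j)) {j : Fin m} {u : Fin n} (hu : u ∈ xpair I j) :
    ∃ w, w ≠ u ∧ xpair I j = {u, w} := by
  have hne : I.vars j 0 ≠ I.vars j 1 := fun h => by
    have := hinj j h
    exact absurd this (by decide)
  rcases (mem_xpair I).1 hu with rfl | rfl
  · exact ⟨I.vars j 1, hne.symm, rfl⟩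
  · exact ⟨I.vars j 0, hne, by rw [xpair, pair_comm]⟩

/-- **Greedy walk.**  In a nonempty leafless `K`, for every `ℓ ≥ 1`: a simple `x`-path with `ℓ` edges, or a nonempty leafless
subset with at most `ℓ` outputs. -/
theorem path_or_small_leafless (hinj : ∀ j, Function.Injective (I.vars j)) {K : Finset (Fin m)} (hK : K.Nonempty)
    (hKl : Leafless I K) :
    ∀ ℓ, 1 ≤ ℓ → (∃ v e, IsXPath I K ℓ v e) ∨ ∃ S ⊆ K, S.Nonempty ∧ Leafless I S ∧ S.card ≤ ℓ := by
  intro ℓ hℓ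
  induction ℓ with
  | zero => omega
  | succ ℓ ih =>
    rcases Nat.eq_zero_or_pos ℓ with rfl | hℓpos
    · -- one edge
      left
      obtain ⟨j, hj⟩ := hK
      have hne : I.vars j 0 ≠ I.vars j 1 := fun h => absurd (hinj j h) (by decide)
      refine ⟨fun i => if i = 0 then I.vars j 0 else I.vars j 1, fun _ => j, ?_, ?_, ?_, ?_⟩
      · intro i hi i' hi' h
        interval_cases i <;> interval_cases i' <;> simp_all
      · intro i hi i' hi' _; omega
      · intro i _; exact hj
      · intro i hi
        interval_cases i
        simp [xpair]
    rcases ih hℓpos with ⟨v, e, hv, he, heK, hxp⟩ | ⟨S, hS, hne, hl, hc⟩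
    swap
    · exact Or.inr ⟨S, hS, hne, hl, by omega⟩
    -- the last vertex lies on the last edge, hence has degree ≥ 2 in `K`
    have hlast : v ℓ ∈ xpair I (e (ℓ - 1)) := by
      rw [hxp (ℓ - 1) (by omega), show ℓ - 1 + 1 = ℓ by omega]
      simp
    have hdeg := two_le_xdeg I hKl (heK (ℓ - 1) (by omega)) hlast
    obtain ⟨j, hjf, hjne⟩ := exists_mem_ne hdeg (e (ℓ - 1))
    rw [mem_filter] at hjf
    obtain ⟨w, hwne, hxj⟩ := exists_other hinj hjf.2
    -- the new edge is not an edge of the path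
    have hjnew : ∀ i < ℓ, e i ≠ j := by
      intro i hi h
      have h1 : v ℓ ∈ xpair I (e i) := by rw [h]; exact hjf.2
      rw [hxp i hi, mem_insert, mem_singleton] at h1
      rcases h1 with h1 | h1
      · have := hv ℓ le_rfl i (by omega) h1; omega
      · have := hv ℓ le_rfl (i + 1) (by omega) h1
        have hi' : i = ℓ - 1 := by omega
        subst hi'
        exact hjne h.symm
    by_cases hw : ∃ i ≤ ℓ, v i = w
    · -- the walk closes up: the closed part is a small leafless set
      obtain ⟨i₀, hi₀, hvi₀⟩ := hw
      have hi₀' : i₀ < ℓ := by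
        rcases Nat.lt_or_ge i₀ ℓ with h | h
        · exact h
        · exfalso
          have : i₀ = ℓ := by omega
          subst this
          exact hwne hvi₀.symm
      right
      refine ⟨(Finset.Ico i₀ ℓ).image e ∪ {j}, ?_, ⟨j, by simp⟩, ?_, ?_⟩
      · intro x hx
        rw [mem_union, mem_image, mem_singleton] at hx
        rcases hx with ⟨i, hi, rfl⟩ | rfl
        · exact heK i (by rw [mem_Ico] at hi; omega)
        · exact hjf.1
      · refine leafless_of_cover I _ (fun x hx u hu => ?_)
        rw [mem_union, mem_image, mem_singleton] at hx
        rcases hx with ⟨k, hk, rfl⟩ | rfl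
        · rw [mem_Ico] at hk
          rw [hxp k hk.2, mem_insert, mem_singleton] at hu
          rcases hu with rfl | rfl
          · -- `u = v k`
            rcases Nat.lt_or_ge i₀ k with hik | hik
            · refine ⟨e (k - 1), ?_, ?_, ?_⟩
              · exact mem_union_left _ (mem_image.2 ⟨k - 1, by rw [mem_Ico]; omega, rfl⟩)
              · intro h; have := he (k - 1) (by omega) k hk.2 h; omega
              · rw [hxp (k - 1) (by omega), show k - 1 + 1 = k by omega]; simp
            · have hk0 : k = i₀ := by omega
              subst hk0
              refine ⟨j, mem_union_right _ (mem_singleton_self _), (hjnew k hk.2).symm, ?_⟩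
              rw [hxj, hvi₀]; simp
          · -- `u = v (k+1)`
            rcases Nat.lt_or_ge (k + 1) ℓ with hk1 | hk1
            · refine ⟨e (k + 1), ?_, ?_, ?_⟩
              · exact mem_union_left _ (mem_image.2 ⟨k + 1, by rw [mem_Ico]; omega, rfl⟩)
              · intro h; have := he (k + 1) hk1 k hk.2 h; omega
              · rw [hxp (k + 1) hk1]; simp
            · have hk2 : k + 1 = ℓ := by omega
              refine ⟨j, mem_union_right _ (mem_singleton_self _), (hjnew k hk.2).symm, ?_⟩
              rw [hk2]; exact hjf.2
        · -- `x = j`, `u ∈ {v ℓ, w}`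
          rw [hxj, mem_insert, mem_singleton] at hu
          rcases hu with rfl | rfl
          · refine ⟨e (ℓ - 1), mem_union_left _ (mem_image.2 ⟨ℓ - 1, by rw [mem_Ico]; omega, rfl⟩),
              hjnew (ℓ - 1) (by omega), hlast⟩
          · refine ⟨e i₀, mem_union_left _ (mem_image.2 ⟨i₀, by rw [mem_Ico]; omega, rfl⟩), hjnew i₀ hi₀', ?_⟩
            rw [hxp i₀ hi₀', ← hvi₀]; simp
      · refine (card_union_le _ _).trans ?_
        rw [card_singleton]
        refine Nat.add_le_add_right (card_image_le.trans ?_) 1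
        rw [Nat.card_Ico]; omega
    · -- extend the path by the new edge
      push Not at hw
      left
      refine ⟨fun i => if i = ℓ + 1 then w else v i, fun i => if i = ℓ then j else e i, ?_, ?_, ?_, ?_⟩
      · intro i hi i' hi' h
        by_cases h1 : i = ℓ + 1 <;> by_cases h2 : i' = ℓ + 1 <;> simp only [h1, h2, if_true, if_false] at h
        · omega
        · exact absurd h.symm (hw i' (by omega))
        · exact absurd h (hw i (by omega))
        · exact hv i (by omega) i' (by omega) h
      · intro i hi i' hi' h
        by_cases h1 : i = ℓ <;> by_cases h2 : i' = ℓ <;> simp only [h1, h2, if_true, if_false] at h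
        · omega
        · exact absurd h.symm (hjnew i' (by omega))
        · exact absurd h (hjnew i (by omega))
        · exact he i (by omega) i' (by omega) h
      · intro i hi
        by_cases h1 : i = ℓ
        · simp only [h1, if_true]; exact hjf.1
        · simp only [h1, if_false]; exact heK i (by omega)
      · intro i hi
        by_cases h1 : i = ℓ
        · subst h1
          simp only [if_true, show i ≠ i + 1 by omega, if_false]
          exact hxj
        · simp only [h1, if_false, show i ≠ ℓ + 1 by omega, show i + 1 ≠ ℓ + 1 by omega]
          exact hxp i (by omega)

/-- **Leaves of a path.**  In the edge set of a simple `x`-path the only vertices of degree one are the two ends. -/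
theorem leaves_of_isXPath {K : Finset (Fin m)} {ℓ : ℕ} {v : ℕ → Fin n} {e : ℕ → Fin m} (hp : IsXPath I K ℓ v e)
    {u : Fin n} (hu : xdeg I ((Finset.range ℓ).image e) u = 1) : u = v 0 ∨ u = v ℓ := by
  obtain ⟨hv, he, -, hxp⟩ := hp
  obtain ⟨j, hj⟩ := card_eq_one.1 hu
  have hjm : j ∈ ((Finset.range ℓ).image e).filter (fun j => u ∈ xpair I j) := by rw [hj]; exact mem_singleton_self _
  rw [mem_filter, mem_image] at hjm
  obtain ⟨⟨k, hk, rfl⟩, huk⟩ := hjm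
  rw [mem_range] at hk
  -- a second edge through `u` would contradict degree one
  have huniq : ∀ k' < ℓ, u ∈ xpair I (e k') → e k' = e k := by
    intro k' hk' hu'
    have : e k' ∈ ((Finset.range ℓ).image e).filter (fun j => u ∈ xpair I j) :=
      mem_filter.2 ⟨mem_image.2 ⟨k', mem_range.2 hk', rfl⟩, hu'⟩
    rw [hj, mem_singleton] at this
    exact this
  rw [hxp k hk, mem_insert, mem_singleton] at huk
  rcases huk with rfl | rfl
  · rcases Nat.eq_zero_or_pos k with rfl | hk0
    · exact Or.inl rfl
    · have h2 : v k ∈ xpair I (e (k - 1)) := by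
        rw [hxp (k - 1) (by omega), show k - 1 + 1 = k by omega]; simp
      have := he (k - 1) (by omega) k hk (huniq (k - 1) (by omega) h2)
      omega
  · rcases Nat.lt_or_ge (k + 1) ℓ with hk1 | hk1
    · have h2 : v (k + 1) ∈ xpair I (e (k + 1)) := by rw [hxp (k + 1) hk1]; simp
      have := he (k + 1) hk1 k hk (huniq (k + 1) hk1 h2)
      omega
    · have : k + 1 = ℓ := by omega
      rw [this]
      exact Or.inr rfl

/-- The edge set of a simple `x`-path of length `ℓ` has exactly `ℓ` outputs. -/
theorem card_image_of_isXPath {K : Finset (Fin m)} {ℓ : ℕ} {v : ℕ → Fin n} {e : ℕ → Fin m} (hp : IsXPath I K ℓ v e) :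
    ((Finset.range ℓ).image e).card = ℓ := by
  rw [card_image_of_injOn, card_range]
  intro i hi i' hi' h
  exact hp.2.1 i (mem_range.1 hi) i' (mem_range.1 hi') h

end Summit.PneNP.PneNP.Theorems.PstarXCore
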